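import Summits.Ventures.YMGap.RobustBall.RobustSlabDisintegration
import HarnessLib

/-!
# Robust ball (Y2), area-law side, part 2a — centre symmetry of the perturbed slab laws

HONEST FRAMING: venture file of the cell `pub-ymgap` (QuantumFields programme), track ROBUST-BALL. Strong-coupling, finite-torus
bookkeeping for a PERTURBED Wilson weight `exp(-Nβ S_W - W)`, `W` bounded measurable (parts 1a/1b: `RobustSlabLaw`,
`RobustSlabDisintegration`).  No area law is concluded in this file (that is `RobustSlabCriterion`); no continuum / mass-gap / Clay
claim anywhere on this track.

§Centre (CNS §2 (P2), perturbed): if `W` is invariant under multiplying every vertical link of the slab `{x_v = t}` by the central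
element `z = e^{2πi/N}·I` (`hWc`), the perturbed slab law `slabLawW v t β W r` is centre symmetric, its one-point functions
`E[(Q_x)_{ij}]`, `E[(Q_x⁻¹)_{ij}]` vanish, and its two-point functions `E[(Q_x)_{ab}(Q_y⁻¹)_{cd}]` are sums of four real covariances
(`norm_integral_entry_mul_inv_entry_slabLawW_le`).

References: Cao–Nissim–Sheffield arXiv:2509.04688v2 §2 (proof of Thm. 2.3); Durhuus–Fröhlich CMP 75 (1980) Thms. 1.2–1.3.
-/

noncomputable section

open MeasureTheory
open Literature.MathematicalPhysics.QuantumLattice (fundamentalRep continuous_fundamentalRep fundamentalRep_apply)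
open Literature.MathematicalPhysics.QuantumFieldTheory
open Literature.MathematicalPhysics.QuantumFieldTheory.DurhuusFrohlich

namespace Summit.Ventures.YMGap.RobustBall

variable {n L N : ℕ}

/-! ### Centre symmetry of the perturbed slab laws -/

section Centre

variable [NeZero L] {W : GaugeConfig (n + 1) L (SU N) → ℝ}


/-- Multiplication of every VERTICAL link of the slab `{x_v = t}` by a fixed group element `z` (used with the central
`z = e^{2πi/N}·I`, `centre N hN`): the slab centre rotation of CNS §2 (P2) seen on torus configurations. [cite: CaoNissimSheffield2025dynamical, §2] -/
def slabRotate (z : SU N) (v : Fin (n + 1)) (t : ZMod L) (U : GaugeConfig (n + 1) L (SU N)) : GaugeConfig (n + 1) L (SU N) :=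
  fun e => if IsSlab v t e then z * U e else U e

omit [NeZero L] in
/-- `centreMul`, evaluated. [folklore] -/
theorem centreMul_apply' (hN : N ≠ 0) (Q : Site n L → SU N) (x : Site n L) : centreMul hN Q x = centre N hN * Q x := rfl

omit [NeZero L] in
/-- Gluing a centre-rotated slab configuration = centre-rotating the glued configuration on the slab. [folklore] -/
theorem glue_centreMul (hN : N ≠ 0) (v : Fin (n + 1)) (t : ZMod L) (Q : Site n L → SU N)
    (r : {e : Edge (n + 1) L // ¬ IsSlab v t e} → SU N) :
    glue v t (centreMul hN Q) r = slabRotate (centre N hN) v t (glue v t Q r) := by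
  funext e
  by_cases h : IsSlab v t e
  · rw [slabRotate, if_pos h, glue_of_isSlab v t _ _ h, glue_of_isSlab v t _ _ h, centreMul_apply']
  · rw [slabRotate, if_neg h, glue_of_not_isSlab v t _ _ h, glue_of_not_isSlab v t _ _ h]

/-- Multiplication by the centre preserves product Haar measure on the slab (left invariance). [folklore] -/
theorem measurePreserving_centreMul' (hN : N ≠ 0) :
    MeasurePreserving (centreMul (n := n) (L := L) hN) (sliceMeasure n L N) (sliceMeasure n L N) :=
  measurePreserving_pi _ _ fun _ => measurePreserving_mul_left (haarProbability (SU N)) _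

/-- The perturbed tilt is centre symmetric when `W` is invariant under the slab centre rotation.
[cite: CaoNissimSheffield2025dynamical, §2] -/
theorem slabTiltW_centreMul (hN : N ≠ 0) (v : Fin (n + 1)) (t : ZMod L) (β : ℝ)
    (hWc : ∀ U, W (slabRotate (centre N hN) v t U) = W U)
    (r : {e : Edge (n + 1) L // ¬ IsSlab v t e} → SU N) (Q : Site n L → SU N) :
    slabTiltW v t β W r (centreMul hN Q) = slabTiltW v t β W r Q := by
  rw [slabTiltW, slabTiltW, slabActionOf_glue, slabActionOf_glue, slabAction_centreMul, glue_centreMul, hWc]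

/-- Integrals against the perturbed slab law are invariant under the centre. [cite: CaoNissimSheffield2025dynamical, §2] -/
theorem integral_slabLawW_centreMul (hN : N ≠ 0) (v : Fin (n + 1)) (t : ZMod L) (β : ℝ)
    (hWc : ∀ U, W (slabRotate (centre N hN) v t U) = W U)
    (r : {e : Edge (n + 1) L // ¬ IsSlab v t e} → SU N) (F : (Site n L → SU N) → ℂ) :
    ∫ Q, F (centreMul hN Q) ∂(slabLawW v t β W r) = ∫ Q, F Q ∂(slabLawW v t β W r) := by
  unfold slabLawW
  rw [integral_tilted, integral_tilted]
  have h := (measurePreserving_centreMul' (n := n) (L := L) hN).integral_comp'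
    (fun Q => (Real.exp (slabTiltW v t β W r Q) / ∫ Q', Real.exp (slabTiltW v t β W r Q') ∂(sliceMeasure n L N)) • F Q)
  simp only [slabTiltW_centreMul hN v t β hWc] at h
  rw [← h]

/-- Matrix entries of a spin are measurable. [folklore] -/
theorem measurable_entry (x : Site n L) (i j : Fin N) :
    Measurable fun Q : Site n L → SU N => ((Q x : SU N) : Matrix (Fin N) (Fin N) ℂ) i j :=
  ((continuous_subtype_val.comp (continuous_apply x)).matrix_elem i j).measurable

/-- Matrix entries of an inverse spin are measurable. [folklore] -/
theorem measurable_inv_entry (x : Site n L) (i j : Fin N) :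
    Measurable fun Q : Site n L → SU N => (((Q x)⁻¹ : SU N) : Matrix (Fin N) (Fin N) ℂ) i j :=
  ((continuous_subtype_val.comp ((continuous_apply x).inv)).matrix_elem i j).measurable

omit [NeZero L] in
/-- Entries of an `SU(N)` matrix have norm `≤ 1`. [folklore] -/
theorem norm_entry_le (g : SU N) (i j : Fin N) : ‖(g : Matrix (Fin N) (Fin N) ℂ) i j‖ ≤ 1 :=
  entry_norm_bound_of_unitary g.2.1 i j

omit [NeZero L] in
/-- The centre element as a matrix. [folklore] -/
theorem coe_centre' (hN : N ≠ 0) :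
    ((centre N hN : SU N) : Matrix (Fin N) (Fin N) ℂ) = rootOfUnity N • (1 : Matrix (Fin N) (Fin N) ℂ) := rfl

omit [NeZero L] in
/-- Multiplication by the centre element scales the matrix. [folklore] -/
theorem coe_centre_mul' (hN : N ≠ 0) (g : SU N) :
    ((centre N hN * g : SU N) : Matrix (Fin N) (Fin N) ℂ) = rootOfUnity N • (g : Matrix (Fin N) (Fin N) ℂ) := by
  rw [Submonoid.coe_mul, coe_centre', Matrix.smul_mul, one_mul]

omit [NeZero L] in
/-- `e^{2πi/N} ≠ 1` for `N ≥ 2`. [folklore] -/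
theorem rootOfUnity_ne_one' (hN : 2 ≤ N) : rootOfUnity N ≠ 1 :=
  (Complex.isPrimitiveRoot_exp N (by omega)).ne_one hN

/-- **One-point functions of the perturbed slab law vanish**: `E[(Q_x)_{ij}] = 0`. [cite: CaoNissimSheffield2025dynamical, §2] -/
theorem integral_entry_slabLawW_eq_zero (hN : 2 ≤ N) (v : Fin (n + 1)) (t : ZMod L) (β : ℝ)
    (hWc : ∀ U, W (slabRotate (centre N (by omega)) v t U) = W U)
    (r : {e : Edge (n + 1) L // ¬ IsSlab v t e} → SU N) (x : Site n L) (i j : Fin N) :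
    ∫ Q, ((Q x : SU N) : Matrix (Fin N) (Fin N) ℂ) i j ∂(slabLawW v t β W r) = 0 := by
  have hN0 : N ≠ 0 := by omega
  have h := integral_slabLawW_centreMul (n := n) (L := L) hN0 v t β hWc r
    (fun Q => ((Q x : SU N) : Matrix (Fin N) (Fin N) ℂ) i j)
  simp only [centreMul_apply', coe_centre_mul', Matrix.smul_apply, smul_eq_mul] at h
  rw [integral_const_mul] at h
  have h1 : (rootOfUnity N - 1) * ∫ Q, ((Q x : SU N) : Matrix (Fin N) (Fin N) ℂ) i j ∂(slabLawW v t β W r) = 0 := by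
    rw [sub_mul, one_mul, h, sub_self]
  rcases mul_eq_zero.1 h1 with h2 | h2
  · exact absurd (sub_eq_zero.1 h2) (rootOfUnity_ne_one' hN)
  · exact h2

/-- **One-point functions of the perturbed slab law vanish**: `E[(Q_x⁻¹)_{ij}] = 0`. [cite: CaoNissimSheffield2025dynamical, §2] -/
theorem integral_inv_entry_slabLawW_eq_zero (hN : 2 ≤ N) (v : Fin (n + 1)) (t : ZMod L) (β : ℝ)
    (hWc : ∀ U, W (slabRotate (centre N (by omega)) v t U) = W U)
    (r : {e : Edge (n + 1) L // ¬ IsSlab v t e} → SU N) (x : Site n L) (i j : Fin N) :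
    ∫ Q, (((Q x)⁻¹ : SU N) : Matrix (Fin N) (Fin N) ℂ) i j ∂(slabLawW v t β W r) = 0 := by
  have hN0 : N ≠ 0 := by omega
  have h := integral_slabLawW_centreMul (n := n) (L := L) hN0 v t β hWc r
    (fun Q => (((Q x)⁻¹ : SU N) : Matrix (Fin N) (Fin N) ℂ) i j)
  simp only [centreMul_apply', coe_inv_SU', coe_centre_mul', star_smul, Matrix.smul_apply, smul_eq_mul] at h
  rw [integral_const_mul] at h
  have h1 : (star (rootOfUnity N) - 1) *
      ∫ Q, (((Q x)⁻¹ : SU N) : Matrix (Fin N) (Fin N) ℂ) i j ∂(slabLawW v t β W r) = 0 := by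
    rw [sub_mul, one_mul]
    simp only [coe_inv_SU']
    rw [h, sub_self]
  rcases mul_eq_zero.1 h1 with h2 | h2
  · exfalso
    have h3 : star (rootOfUnity N) = 1 := sub_eq_zero.1 h2
    have h4 : rootOfUnity N = 1 := by simpa using congrArg star h3
    exact rootOfUnity_ne_one' hN h4
  · simpa only [coe_inv_SU'] using h2

open ProbabilityTheory in
/-- **Two-point functions of the perturbed slab law are covariances**: for centre-invariant `W`,
`‖E[(Q_x)_{ab}(Q_y⁻¹)_{cd}]‖ ≤ 4 C` whenever the four real covariances of `Re/Im` parts are bounded by `C`.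
[cite: CaoNissimSheffield2025dynamical, §2] -/
theorem norm_integral_entry_mul_inv_entry_slabLawW_le (hN : 2 ≤ N) (v : Fin (n + 1)) (t : ZMod L) (β : ℝ)
    (hWm : Measurable W) (hWb : ∃ C, ∀ U, |W U| ≤ C)
    (hWc : ∀ U, W (slabRotate (centre N (by omega)) v t U) = W U)
    (r : {e : Edge (n + 1) L // ¬ IsSlab v t e} → SU N) (x y : Site n L) {C : ℝ}
    (hcov : ∀ (i j k l : Fin N) (φ ψ : ℂ → ℝ),
      (φ = Complex.re ∨ φ = Complex.im) → (ψ = Complex.re ∨ ψ = Complex.im) →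
        |cov[fun Q => φ ((Q x : Matrix (Fin N) (Fin N) ℂ) i j),
            fun Q => ψ ((((Q y)⁻¹ : Matrix.specialUnitaryGroup (Fin N) ℂ) :
              Matrix (Fin N) (Fin N) ℂ) k l); slabLawW v t β W r]| ≤ C)
    (a b c d : Fin N) :
    ‖∫ Q, ((Q x : SU N) : Matrix (Fin N) (Fin N) ℂ) a b * (((Q y)⁻¹ : SU N) : Matrix (Fin N) (Fin N) ℂ) c d
        ∂(slabLawW v t β W r)‖ ≤ 4 * C := by
  haveI := isProbabilityMeasure_slabLawW (n := n) (L := L) (N := N) v t β hWm hWb r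
  set μ := slabLawW (n := n) (L := L) v t β W r with hμ
  set f : (Site n L → SU N) → ℂ := fun Q => ((Q x : SU N) : Matrix (Fin N) (Fin N) ℂ) a b with hf
  set g : (Site n L → SU N) → ℂ := fun Q => (((Q y)⁻¹ : SU N) : Matrix (Fin N) (Fin N) ℂ) c d with hg
  have hfm : Measurable f := measurable_entry x a b
  have hgm : Measurable g := measurable_inv_entry y c d
  have hfb : ∀ Q, ‖f Q‖ ≤ 1 := fun Q => norm_entry_le _ a b
  have hgb : ∀ Q, ‖g Q‖ ≤ 1 := fun Q => norm_entry_le _ c d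
  set fr : (Site n L → SU N) → ℝ := fun Q => (f Q).re with hfr
  set fi : (Site n L → SU N) → ℝ := fun Q => (f Q).im with hfi
  set gr : (Site n L → SU N) → ℝ := fun Q => (g Q).re with hgr
  set gi : (Site n L → SU N) → ℝ := fun Q => (g Q).im with hgi
  have hre1 : ∀ {h : (Site n L → SU N) → ℂ}, (∀ Q, ‖h Q‖ ≤ 1) → ∀ Q, ‖(h Q).re‖ ≤ 1 :=
    fun hb Q => (Complex.abs_re_le_norm _).trans (hb Q)
  have him1 : ∀ {h : (Site n L → SU N) → ℂ}, (∀ Q, ‖h Q‖ ≤ 1) → ∀ Q, ‖(h Q).im‖ ≤ 1 :=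
    fun hb Q => (Complex.abs_im_le_norm _).trans (hb Q)
  have hL2 : ∀ {u : (Site n L → SU N) → ℝ}, Measurable u → (∀ Q, ‖u Q‖ ≤ 1) → MemLp u 2 μ :=
    fun hm hb => MemLp.of_bound hm.aestronglyMeasurable 1 (ae_of_all _ hb)
  have hmul : ∀ {u w : (Site n L → SU N) → ℝ}, Measurable u → Measurable w → (∀ Q, ‖u Q‖ ≤ 1) →
      (∀ Q, ‖w Q‖ ≤ 1) → Integrable (fun Q => u Q * w Q) μ := fun hu hw hub hwb =>
    Integrable.of_bound (hu.mul hw).aestronglyMeasurable 1 (ae_of_all _ fun Q => by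
      rw [norm_mul]; exact mul_le_one₀ (hub Q) (norm_nonneg _) (hwb Q))
  have hfrm : Measurable fr := Complex.measurable_re.comp hfm
  have hfim : Measurable fi := Complex.measurable_im.comp hfm
  have hgrm : Measurable gr := Complex.measurable_re.comp hgm
  have hgim : Measurable gi := Complex.measurable_im.comp hgm
  have hfr2 : MemLp fr 2 μ := hL2 hfrm (hre1 hfb)
  have hfi2 : MemLp fi 2 μ := hL2 hfim (him1 hfb)
  have hgr2 : MemLp gr 2 μ := hL2 hgrm (hre1 hgb)
  have hgi2 : MemLp gi 2 μ := hL2 hgim (him1 hgb)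
  have hfint : Integrable f μ := Integrable.of_bound hfm.aestronglyMeasurable 1 (ae_of_all _ hfb)
  have hf0 : ∫ Q, f Q ∂μ = 0 := integral_entry_slabLawW_eq_zero hN v t β hWc r x a b
  have hfr0 : ∫ Q, fr Q ∂μ = 0 := by
    have := integral_re hfint; simp only [RCLike.re_to_complex, hf0, Complex.zero_re] at this; exact this
  have hfi0 : ∫ Q, fi Q ∂μ = 0 := by
    have := integral_im hfint; simp only [RCLike.im_to_complex, hf0, Complex.zero_im] at this; exact this
  have hprod : Integrable (fun Q => f Q * g Q) μ :=
    Integrable.of_bound (hfm.mul hgm).aestronglyMeasurable 1 (ae_of_all _ fun Q => by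
      rw [norm_mul]; exact mul_le_one₀ (hfb Q) (norm_nonneg _) (hgb Q))
  have hre : (∫ Q, f Q * g Q ∂μ).re = cov[fr, gr; μ] - cov[fi, gi; μ] := by
    have h1 := integral_re hprod
    simp only [RCLike.re_to_complex, Complex.mul_re] at h1
    rw [← h1, integral_sub (hmul hfrm hgrm (hre1 hfb) (hre1 hgb)) (hmul hfim hgim (him1 hfb) (him1 hgb)),
      covariance_eq_sub hfr2 hgr2, covariance_eq_sub hfi2 hgi2, hfr0, hfi0]
    simp only [zero_mul, sub_zero]
    rfl
  have him : (∫ Q, f Q * g Q ∂μ).im = cov[fr, gi; μ] + cov[fi, gr; μ] := by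
    have h1 := integral_im hprod
    simp only [RCLike.im_to_complex, Complex.mul_im] at h1
    rw [← h1, integral_add (hmul hfrm hgim (hre1 hfb) (him1 hgb)) (hmul hfim hgrm (him1 hfb) (hre1 hgb)),
      covariance_eq_sub hfr2 hgi2, covariance_eq_sub hfi2 hgr2, hfr0, hfi0]
    simp only [zero_mul, sub_zero]
    rfl
  have c1 := hcov a b c d Complex.re Complex.re (Or.inl rfl) (Or.inl rfl)
  have c2 := hcov a b c d Complex.im Complex.im (Or.inr rfl) (Or.inr rfl)
  have c3 := hcov a b c d Complex.re Complex.im (Or.inl rfl) (Or.inr rfl)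
  have c4 := hcov a b c d Complex.im Complex.re (Or.inr rfl) (Or.inl rfl)
  calc ‖∫ Q, f Q * g Q ∂μ‖ ≤ |(∫ Q, f Q * g Q ∂μ).re| + |(∫ Q, f Q * g Q ∂μ).im| :=
        Complex.norm_le_abs_re_add_abs_im _
    _ = |cov[fr, gr; μ] - cov[fi, gi; μ]| + |cov[fr, gi; μ] + cov[fi, gr; μ]| := by rw [hre, him]
    _ ≤ (|cov[fr, gr; μ]| + |cov[fi, gi; μ]|) + (|cov[fr, gi; μ]| + |cov[fi, gr; μ]|) :=
        add_le_add (abs_sub _ _) (abs_add_le _ _)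
    _ ≤ (C + C) + (C + C) := add_le_add (add_le_add c1 c2) (add_le_add c3 c4)
    _ = 4 * C := by ring

end Centre

end Summit.Ventures.YMGap.RobustBall
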